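import Mathlib
import Literature.Geometry.Riemannian.PerelmanEntropy
import Literature.Geometry.Riemannian.RicciFlowScaling
import Literature.Geometry.Riemannian.RicciFlowMaximalScaling
import Literature.Geometry.Riemannian.KappaNoncollapsingScaling
import Literature.Geometry.Riemannian.WeylEnergyScaling
import Literature.Geometry.Riemannian.MetricTraceScaling
import HarnessLib

/-!
# Candidate proof of the registered stub `stub_rescaledSequence`
(line `ancient-sphere-rigidity`, lead reshape r2, crux stmt-SmoothPoincare4-10869).

Statement verbatim from `Lines/ancient-sphere-rigidity.lean`. Fact-free proof (refuter-drefute,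
2026-08-16): `g_k(s) := Q_k · g(Q_k⁻¹ s + t_k)`, `cov_k(s) := cov(Q_k⁻¹ s + t_k)`, `A_k := Q_k t_k`,
`κ' = κ`, `δ'' = δ'`, `c = 1/2`; Ricci flow by time translation + `IsRicciFlow.parabolicRescale`;
`|Rm| ≤ 1` by `curvatureBoundedBy_constSmul_iff`; the picked quadruple rescaled by `(√Q_k)⁻¹`
(`curvatureForm_constSmul`, `curvatureForm_smul_smul_smul_smul`); `κ`-noncollapsing by
`IsKappaNoncollapsed.parabolicRescale` + time translation + restriction of the time set; the floor by
the scale invariance `μ(Q g, ∇, τ) = μ(g, ∇, Q⁻¹ τ)` (Topping 2006 Prop. 8.1.2), proved here in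
dimension 4 over the tree's Bochner `𝒲` (`riemVolume_constSmul`, `gradSq_constSmul`,
`scalarCurvatureWith_constSmul`).
-/

noncomputable section

open scoped Manifold ContDiff Topology ENNReal
open Set Function MeasureTheory Module
open Literature.Geometry.Lorentzian Literature.Geometry.Riemannian
open Literature.Geometry.Lorentzian.PseudoRiemannianMetric

namespace Summit.SmoothPoincare4.SmoothPoincare4.Cruxes.SubcylindricalRecognition.AncientSphereRigidity.Refuter

/-! ### Scale invariance of `𝒲`, compatibility and `μ` (dimension 4) -/

/-- `(c⁻¹ y)^{-4/2} = c² · y^{-4/2}` for `c > 0`, `y ≥ 0`. [folklore] -/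
theorem rpow_negTwo_inv_mul {c y : ℝ} (hc : 0 < c) (hy : 0 ≤ y) :
    (c⁻¹ * y) ^ (-(4 : ℝ) / 2) = c ^ 2 * y ^ (-(4 : ℝ) / 2) := by
  have h2 : (-(4 : ℝ) / 2) = -2 := by norm_num
  rw [h2, Real.mul_rpow (inv_nonneg.2 hc.le) hy, Real.rpow_neg (inv_nonneg.2 hc.le),
    Real.inv_rpow hc.le, inv_inv]
  norm_num [Real.rpow_two]

/-- The density at scale `c⁻¹ τ` is `c²` times the density at scale `τ` (dimension 4, `τ ≥ 0`).
[folklore] -/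
theorem entropyDensity_inv_mul {M : Type*} (f : M → ℝ) {c τ : ℝ} (hc : 0 < c) (hτ : 0 ≤ τ) (x : M) :
    entropyDensity 4 f (c⁻¹ * τ) x = c ^ 2 * entropyDensity 4 f τ x := by
  simp only [entropyDensity_apply]
  have : (4 * Real.pi * (c⁻¹ * τ)) = c⁻¹ * (4 * Real.pi * τ) := by ring
  rw [this, show ((4 : ℕ) : ℝ) = 4 by norm_num, rpow_negTwo_inv_mul hc (by positivity)]
  ring

section Scaling

variable {M : Type*} [TopologicalSpace M] [ChartedSpace (EuclideanSpace ℝ (Fin 4)) M]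
  [IsManifold (𝓡 4) ∞ M] [T3Space M] [MeasurableSpace M] [BorelSpace M]

local notation "Met" M => PseudoRiemannianMetric (𝓡 4) ∞ (EuclideanSpace ℝ (Fin 4))
  (TangentSpace (𝓡 4) : M → Type _)

/-- `finrank ℝ ℝ⁴ = 4`. [folklore] -/
theorem finrank_four : finrank ℝ (EuclideanSpace ℝ (Fin 4)) = 4 := by simp

/-- **Volume scaling in dimension 4 as measures**: `dV_{c g} = c² dV_g`. [folklore] -/
theorem riemVolume_constSmul_four (g : Met M) {c : ℝ} (hc : 0 < c) :
    (g.constSmul c hc.ne').riemVolume = ENNReal.ofReal (c ^ 2) • g.riemVolume := by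
  rw [riemVolume_constSmul g hc, finrank_four, ← ENNReal.ofReal_pow (Real.sqrt_nonneg c)]
  congr 2
  rw [show (4 : ℕ) = 2 * 2 from rfl, pow_mul, Real.sq_sqrt hc.le]

/-- **Scale invariance of `𝒲`** (Topping 2006, Prop. 8.1.2), dimension 4, for the tree's Bochner
`𝒲` (both sides junk `0` together): `𝒲(c g, ∇, f, τ) = 𝒲(g, ∇, f, c⁻¹ τ)` for `c > 0`, `τ ≥ 0`.
[cite: Topping2006, Prop. 8.1.2] -/
theorem wEntropy_constSmul (g : Met M) (cov : CovariantDerivative (𝓡 4) (EuclideanSpace ℝ (Fin 4))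
      (TangentSpace (𝓡 4) : M → Type _)) (f : M → ℝ) {c τ : ℝ} (hc : 0 < c) (hτ : 0 ≤ τ) :
    (g.constSmul c hc.ne').wEntropy cov f τ = g.wEntropy cov f (c⁻¹ * τ) := by
  rw [wEntropy_def, wEntropy_def, riemVolume_constSmul_four g hc, integral_smul_measure,
    ENNReal.toReal_ofReal (by positivity), finrank_four]
  simp only [gradSq_constSmul, scalarCurvatureWith_constSmul, entropyDensity_inv_mul f hc hτ]
  rw [smul_eq_mul, ← integral_const_mul]
  congr 1
  funext x
  ring

/-- **Scale invariance of compatibility**: `(c g, f, τ)` compatible iff `(g, f, c⁻¹ τ)` compatible.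
[cite: Topping2006, Prop. 8.1.2] -/
theorem isEntropyCompatible_constSmul_iff (g : Met M) (f : M → ℝ) {c τ : ℝ} (hc : 0 < c)
    (hτ : 0 ≤ τ) :
    (g.constSmul c hc.ne').IsEntropyCompatible f τ ↔ g.IsEntropyCompatible f (c⁻¹ * τ) := by
  rw [isEntropyCompatible_iff, isEntropyCompatible_iff, riemVolume_constSmul_four g hc,
    integral_smul_measure, ENNReal.toReal_ofReal (by positivity), finrank_four]
  simp only [entropyDensity_inv_mul f hc hτ]
  rw [integral_const_mul, smul_eq_mul]

/-- **Scale invariance of `μ`** (Topping 2006, Prop. 8.1.2 ⇒ (8.1.6)): `μ(c g, ∇, τ) = μ(g, ∇, c⁻¹ τ)`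
for `c > 0`, `τ ≥ 0` (dimension 4, tree definitions). [cite: Topping2006, Prop. 8.1.2] -/
theorem muEntropy_constSmul (g : Met M) (cov : CovariantDerivative (𝓡 4) (EuclideanSpace ℝ (Fin 4))
      (TangentSpace (𝓡 4) : M → Type _)) {c τ : ℝ} (hc : 0 < c) (hτ : 0 ≤ τ) :
    (g.constSmul c hc.ne').muEntropy cov τ = g.muEntropy cov (c⁻¹ * τ) := by
  have key : ∀ a : EReal,
      a ≤ (g.constSmul c hc.ne').muEntropy cov τ ↔ a ≤ g.muEntropy cov (c⁻¹ * τ) := by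
    intro a
    rw [le_muEntropy_iff, le_muEntropy_iff]
    constructor
    · intro h f' hf' hcf'
      have := h f' hf' ((isEntropyCompatible_constSmul_iff g f' hc hτ).2 hcf')
      rwa [wEntropy_constSmul g cov f' hc hτ] at this
    · intro h f' hf' hcf'
      have := h f' hf' ((isEntropyCompatible_constSmul_iff g f' hc hτ).1 hcf')
      rwa [wEntropy_constSmul g cov f' hc hτ]
  exact le_antisymm ((key _).1 le_rfl) ((key _).2 le_rfl)

/-! ### `κ`-noncollapsing: time translation and restriction of the time set -/

/-- `κ`-noncollapsing on `S` restricts to every `S' ⊆ S` (fewer admissible parabolic balls). [folklore] -/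
theorem isKappaNoncollapsed_mono_set {g : ℝ → Met M}
    {cov : ℝ → CovariantDerivative (𝓡 4) (EuclideanSpace ℝ (Fin 4)) (TangentSpace (𝓡 4) : M → Type _)}
    {S S' : Set ℝ} {κ r₀ : ℝ} (h : IsKappaNoncollapsed g cov S κ r₀) (hS : S' ⊆ S) :
    IsKappaNoncollapsed g cov S' κ r₀ :=
  fun x₀ t₀ hI hcurv ↦ h x₀ t₀ (hI.trans hS) hcurv

/-- `κ`-noncollapsing is invariant under time translation `t ↦ t + a`. [folklore] -/
theorem isKappaNoncollapsed_comp_add_const {g : ℝ → Met M}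
    {cov : ℝ → CovariantDerivative (𝓡 4) (EuclideanSpace ℝ (Fin 4)) (TangentSpace (𝓡 4) : M → Type _)}
    {S : Set ℝ} {κ r₀ : ℝ} (h : IsKappaNoncollapsed g cov S κ r₀) (a : ℝ) :
    IsKappaNoncollapsed (fun t ↦ g (t + a)) (fun t ↦ cov (t + a)) ((· + a) ⁻¹' S) κ r₀ := by
  intro x₀ t₀ hI hcurv
  have hI' : Icc (t₀ + a - r₀ ^ 2) (t₀ + a) ⊆ S := by
    intro u hu
    have hu' : u - a ∈ Icc (t₀ - r₀ ^ 2) t₀ := ⟨by linarith [hu.1], by linarith [hu.2]⟩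
    have := hI hu'
    simpa using this
  have hcurv' : ∀ u ∈ Icc (t₀ + a - r₀ ^ 2) (t₀ + a),
      CurvatureBoundedOn (g u) (cov u) ((g u).ball x₀ (ENNReal.ofReal r₀)) (r₀⁻¹ ^ 2) := by
    intro u hu
    have hu' : u - a ∈ Icc (t₀ - r₀ ^ 2) t₀ := ⟨by linarith [hu.1], by linarith [hu.2]⟩
    have := hcurv (u - a) hu'
    simpa using this
  simpa using h x₀ (t₀ + a) hI' hcurv'

end Scaling

/-! ### The stub -/

/-- **Parabolic rescaling of the picked sequence** (Hamilton 1995 §16; Topping 2006 (1.2.7),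
Prop. 8.1.2): sorry-free proof of the registered stub `stub_rescaledSequence` (type verbatim). [folklore] -/
theorem stub_rescaledSequence_proof :
    ∀ (M : Type) [TopologicalSpace M] [T2Space M] [SecondCountableTopology M]
      [ChartedSpace (EuclideanSpace ℝ (Fin 4)) M] [IsManifold (𝓡 4) ∞ M] [CompactSpace M]
      [ConnectedSpace M] [T3Space M] [MeasurableSpace M] [BorelSpace M] (T δ' κ : ℝ),
      0 < δ' → 0 < κ →
      ∀ (g : ℝ → PseudoRiemannianMetric (𝓡 4) ∞ (EuclideanSpace ℝ (Fin 4)) (TangentSpace (𝓡 4) : M → Type _))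
        (cov : ℝ → CovariantDerivative (𝓡 4) (EuclideanSpace ℝ (Fin 4)) (TangentSpace (𝓡 4) : M → Type _)),
      IsMaximalRicciFlow g cov T →
      (∀ r₀ : ℝ, 0 < r₀ → r₀ < Real.sqrt T → IsKappaNoncollapsed g cov (Set.Ico 0 T) κ r₀) →
      (∀ t ∈ Set.Ico 0 T, ∀ τ : ℝ, 0 < τ →
        ((Real.log 2 + Real.log Real.pi / 2 - 3 / 2 + δ' : ℝ) : EReal) ≤ (g t).muEntropy (cov t) τ) →
      ∀ (tk Qk : ℕ → ℝ) (xk : ℕ → M),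
      (∀ k, tk k ∈ Set.Ico 0 T) → (∀ k, 0 < Qk k) → (∀ k : ℕ, (k : ℝ) ≤ Qk k * tk k) →
      (∀ k, ∀ t ∈ Set.Icc 0 (tk k), CurvatureBoundedBy (g t) (cov t) (Qk k)) →
      (∀ k, ∃ X Y Z W : TangentSpace (𝓡 4) (xk k),
        (g (tk k)).val (xk k) X X ≤ 1 ∧ (g (tk k)).val (xk k) Y Y ≤ 1 ∧
        (g (tk k)).val (xk k) Z Z ≤ 1 ∧ (g (tk k)).val (xk k) W W ≤ 1 ∧
        Qk k / 2 ≤ |(g (tk k)).curvatureForm (cov (tk k)) (xk k) X Y Z W|) →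
      ∃ (κ' δ'' c : ℝ), 0 < κ' ∧ 0 < δ'' ∧ 0 < c ∧
        ∃ (A : ℕ → ℝ)
          (gk : ℕ → ℝ → PseudoRiemannianMetric (𝓡 4) ∞ (EuclideanSpace ℝ (Fin 4)) (TangentSpace (𝓡 4) : M → Type _))
          (covk : ℕ → ℝ → CovariantDerivative (𝓡 4) (EuclideanSpace ℝ (Fin 4)) (TangentSpace (𝓡 4) : M → Type _))
          (xk' : ℕ → M),
          (∀ k : ℕ, (k : ℝ) ≤ A k) ∧
          (∀ k, IsRicciFlow (gk k) (covk k) (Set.Icc (-(A k)) 0)) ∧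
          (∀ k, ∀ t ∈ Set.Icc (-(A k)) 0, (gk k t).IsRiemannian) ∧
          (∀ k, ∀ t ∈ Set.Icc (-(A k)) 0, CurvatureBoundedBy (gk k t) (covk k t) 1) ∧
          (∀ k, ∃ X Y Z W : TangentSpace (𝓡 4) (xk' k),
            (gk k 0).val (xk' k) X X ≤ 1 ∧ (gk k 0).val (xk' k) Y Y ≤ 1 ∧
            (gk k 0).val (xk' k) Z Z ≤ 1 ∧ (gk k 0).val (xk' k) W W ≤ 1 ∧
            c ≤ |(gk k 0).curvatureForm (covk k 0) (xk' k) X Y Z W|) ∧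
          (∀ k, ∀ r₀ : ℝ, 0 < r₀ → r₀ < Real.sqrt (A k) →
            IsKappaNoncollapsed (gk k) (covk k) (Set.Icc (-(A k)) 0) κ' r₀) ∧
          (∀ k, ∀ t ∈ Set.Icc (-(A k)) 0, ∀ τ : ℝ, 0 < τ →
            ((Real.log 2 + Real.log Real.pi / 2 - 3 / 2 + δ'' : ℝ) : EReal) ≤
              (gk k t).muEntropy (covk k t) τ) := by
  intro M _ _ _ _ _ _ _ _ _ _ T δ' κ hδ' hκ g cov hmax hnc hfl tk Qk xk htk hQk hA hbd hpick
  -- the original time of the rescaled time `s` of the `k`-th flow lies in `[0, t_k]`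
  have horig : ∀ k, ∀ s ∈ Icc (-(Qk k * tk k)) 0,
      (Qk k)⁻¹ * s + tk k ∈ Icc 0 (tk k) := by
    intro k s hs
    have hQ := hQk k
    have hQi : 0 < (Qk k)⁻¹ := inv_pos.2 hQ
    constructor
    · have h1 : (Qk k)⁻¹ * (-(Qk k * tk k)) ≤ (Qk k)⁻¹ * s := mul_le_mul_of_nonneg_left hs.1 hQi.le
      have h2 : (Qk k)⁻¹ * (-(Qk k * tk k)) = -tk k := by field_simp
      linarith
    · have h1 : (Qk k)⁻¹ * s ≤ 0 := mul_nonpos_of_nonneg_of_nonpos hQi.le hs.2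
      linarith
  have horigT : ∀ k, ∀ s ∈ Icc (-(Qk k * tk k)) 0, (Qk k)⁻¹ * s + tk k ∈ Ico 0 T := fun k s hs ↦
    ⟨(horig k s hs).1, lt_of_le_of_lt (horig k s hs).2 (htk k).2⟩
  refine ⟨κ, δ', 1 / 2, hκ, hδ', by norm_num, fun k ↦ Qk k * tk k,
    fun k s ↦ (g ((Qk k)⁻¹ * s + tk k)).constSmul (Qk k) (hQk k).ne',
    fun k s ↦ cov ((Qk k)⁻¹ * s + tk k), xk, hA, ?_, ?_, ?_, ?_, ?_, ?_⟩
  · -- Ricci flow on `[-A_k, 0]`: time translation by `t_k`, parabolic rescaling by `Q_k`, restriction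
    intro k
    have h1 := (hmax.isRicciFlow.comp_add_const (tk k)).parabolicRescale (hQk k)
    refine h1.mono ?_
    intro s hs
    simp only [mem_preimage]
    exact horigT k s hs
  · -- Riemannian
    intro k s hs
    exact (hmax.isRiemannian _ (horigT k s hs)).constSmul (hQk k)
  · -- `|Rm| ≤ 1`
    intro k s hs
    rw [curvatureBoundedBy_constSmul_iff _ _ (hQk k), mul_one]
    exact hbd k _ (horig k s hs)
  · -- the picked quadruple, rescaled by `(√Q_k)⁻¹`
    intro k
    obtain ⟨X, Y, Z, W, hX, hY, hZ, hW, hRm⟩ := hpick k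
    have hQ := hQk k
    set a : ℝ := (Real.sqrt (Qk k))⁻¹ with ha
    have hsq : Real.sqrt (Qk k) ^ 2 = Qk k := Real.sq_sqrt hQ.le
    have ha2' : a ^ 2 = (Qk k)⁻¹ := by
      rw [ha, inv_pow, hsq]
    have ha2 : Qk k * a ^ 2 = 1 := by
      rw [ha2', mul_inv_cancel₀ hQ.ne']
    have ha4 : Qk k * a ^ 4 = (Qk k)⁻¹ := by
      have : a ^ 4 = (a ^ 2) ^ 2 := by ring
      rw [this, ha2']
      field_simp
    have h0 : (Qk k)⁻¹ * 0 + tk k = tk k := by ring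
    have hunit : ∀ V : TangentSpace (𝓡 4) (xk k), (g (tk k)).val (xk k) V V ≤ 1 →
        ((g ((Qk k)⁻¹ * 0 + tk k)).constSmul (Qk k) hQ.ne').val (xk k) (a • V) (a • V) ≤ 1 := by
      intro V hV
      rw [h0, constSmul_apply]
      simp only [map_smul, smul_eq_mul]
      calc Qk k * (a * (a * (g (tk k)).val (xk k) V V))
          = (Qk k * a ^ 2) * (g (tk k)).val (xk k) V V := by ring
        _ = (g (tk k)).val (xk k) V V := by rw [ha2, one_mul]
        _ ≤ 1 := hV
    refine ⟨a • X, a • Y, a • Z, a • W, hunit X hX, hunit Y hY, hunit Z hZ, hunit W hW, ?_⟩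
    beta_reduce
    rw [h0, curvatureForm_constSmul, Literature.Geometry.Riemannian.curvatureForm_smul_smul_smul_smul,
      ← mul_assoc, ha4, abs_mul,
      abs_inv, abs_of_pos hQ]
    -- `1/2 ≤ Q⁻¹ |Rm|` from `Q/2 ≤ |Rm|`
    rw [le_inv_mul_iff₀ hQ]
    linarith
  · -- `κ`-noncollapsing below `√A_k`
    intro k r hr hrA
    have hQ := hQk k
    have hsQ : 0 < Real.sqrt (Qk k) := Real.sqrt_pos.2 hQ
    -- the original scale `r₀ := r / √Q_k < √t_k ≤ √T`
    set r₀ : ℝ := r / Real.sqrt (Qk k) with hr₀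
    have hr₀pos : 0 < r₀ := div_pos hr hsQ
    have hr₀T : r₀ < Real.sqrt T := by
      have h1 : r₀ < Real.sqrt (tk k) := by
        rw [hr₀, div_lt_iff₀ hsQ]
        rw [Real.sqrt_mul hQ.le] at hrA
        linarith
      exact h1.trans_le (Real.sqrt_le_sqrt (htk k).2.le)
    have hK := (hnc r₀ hr₀pos hr₀T).parabolicRescale (a := Qk k) hQ hr₀pos.le
    have hscale : Real.sqrt (Qk k) * r₀ = r := by
      rw [hr₀]; field_simp
    rw [hscale] at hK
    -- translate by `Q_k t_k` and restrict to `[-A_k, 0]`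
    have hK' := isKappaNoncollapsed_comp_add_const hK (Qk k * tk k)
    have hfun : (fun t ↦ (g ((Qk k)⁻¹ * (t + Qk k * tk k))).constSmul (Qk k) hQ.ne') =
        fun s ↦ (g ((Qk k)⁻¹ * s + tk k)).constSmul (Qk k) hQ.ne' := by
      funext s
      have : (Qk k)⁻¹ * (s + Qk k * tk k) = (Qk k)⁻¹ * s + tk k := by field_simp
      rw [this]
    have hcov : (fun t ↦ cov ((Qk k)⁻¹ * (t + Qk k * tk k))) = fun s ↦ cov ((Qk k)⁻¹ * s + tk k) := by
      funext s
      have : (Qk k)⁻¹ * (s + Qk k * tk k) = (Qk k)⁻¹ * s + tk k := by field_simp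
      rw [this]
    rw [hfun, hcov] at hK'
    refine isKappaNoncollapsed_mono_set hK' ?_
    intro s hs
    simp only [mem_preimage, mem_Ico]
    constructor
    · linarith [hs.1]
    · have := (htk k).2
      have h2 : s + Qk k * tk k ≤ Qk k * tk k := by linarith [hs.2]
      calc s + Qk k * tk k ≤ Qk k * tk k := h2
        _ < Qk k * T := mul_lt_mul_of_pos_left this hQ
  · -- the floor, by scale invariance of `μ`
    intro k s hs τ hτ
    have hQ := hQk k
    show ((Real.log 2 + Real.log Real.pi / 2 - 3 / 2 + δ' : ℝ) : EReal) ≤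
      ((g ((Qk k)⁻¹ * s + tk k)).constSmul (Qk k) hQ.ne').muEntropy (cov ((Qk k)⁻¹ * s + tk k)) τ
    rw [muEntropy_constSmul _ _ hQ hτ.le]
    exact hfl _ (horigT k s hs) _ (mul_pos (inv_pos.2 hQ) hτ)

end Summit.SmoothPoincare4.SmoothPoincare4.Cruxes.SubcylindricalRecognition.AncientSphereRigidity.Refuter

end
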